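import Summits.AtomisticToContinuum.HydrodynamicLimit.Theorems.MourreKoopmanChargesOneBodyCompletenessFramework
import Summits.AtomisticToContinuum.HydrodynamicLimit.Theorems.MourreKoopmanChargesStressStrongMixingStressFramework
import Summits.AtomisticToContinuum.HydrodynamicLimit.Theorems.AntiMazurCoboundariesCorrectorPressureDecayKiferDiluteGibbs
import Literature.Analysis.FluidPDE.InfiniteHardSphereKoopman
import HarnessLib

/-!
# `OneBodyCompleteness` (crux stmt-AtomisticToContinuum-9583, route `MourreKoopmanCharges`):
# static / dynamic split of the framework and the discharge of the static half from Ruelle's theorem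

Helper file (`--supports stmt-AtomisticToContinuum-9583`, line `registered`, skeleton v5 of
`Cruxes/OneBodyCompleteness/Lines/birth.lean`). The v4 reduction `oneBodyCompleteness_of_frameworkNoOrth`
(file `…OneBodyCompletenessFramework.lean`) takes ONE framework hypothesis: existence of a dilute
unit-diameter, unit-inverse-temperature Gibbs state of density `σ³` packaged as fluctuation data with
Alexander flow, strongly continuous Koopman group and admissible one-body cell observables. Here that
hypothesis is SPLIT into

* a STATIC half — a translation-invariant DLR state `G` of unit hard spheres with `M_1` marks,
  activity `0 < z ≤ 2σ³` and density exactly `σ³` below a threshold `σ₁` (equilibrium statistical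
  mechanics: `Theorems.KiferCompactification.DiluteGibbsState` at `θ = 1`, `u₀ = 0`), which
  `diluteGibbsStateUnit_of_ruelle` derives from the named fact `RuelleDiluteHardSphereGas` (Ruelle 1969
  Thm 4.2.3 / 4.3.1, the low-activity gas and its continuous density `ρ(z) = z + O(z²)`) through the
  landed `stub_diluteGibbsStateOfFact` (intermediate value theorem on `[σ³, 2σ³]`);
* a DYNAMIC half — the packaging of every such `G` as `F : HardSphereFluctuationData 1` with `F.μ = G`
  (Alexander's flow, a.e. shift commutation, space-time clustering; the genuinely dynamical input);

glued by `frameworkNoOrth_of_split` (thresholds by `min`; `z ≤ 2σ³ ≤ 2σ < z₀` for `σ < min 2⁻¹ (z₀/2)`;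
the density clause `∫ cellCharge 0 ∂F.μ = σ³` from `PointProcess.density G = σ³` by
`integral_cellCharge_zero_eq_toReal_density`, the hard core holding a.e. because the equilibrium flow is
a.e. defined on the Gibbs state). Consequences: `oneBodyCompleteness_of_split` (the v5 composition as a
theorem) and `oneBodyCompleteness_of_ruelle :
RuelleDiluteHardSphereGas → (packaging) → (identification) → ChargesCompleteHS → OneBodyCompleteness`.

References: D. Ruelle, *Statistical Mechanics: Rigorous Results* (1969), Thm 4.2.3, Thm 4.3.1, (3.12);
R. Alexander, Comm. Math. Phys. 49 (1976) Thm 5.2; H. Spohn, *Large Scale Dynamics of Interacting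
Particles* (1991), Part I §7.1.
-/

noncomputable section

namespace Summit.AtomisticToContinuum.HydrodynamicLimit.Theorems.MourreKoopmanChargesOneBodyCompleteness

open scoped BigOperators Topology InnerProductSpace ENNReal
open Filter Set Function MeasureTheory ProbabilityTheory

/-- **The static half from Ruelle's theorem**: the named fact `RuelleDiluteHardSphereGas` gives, below a
reduced-diameter threshold, a translation-invariant unit-diameter DLR Gibbs state with `M_1` marks,
activity `0 < z ≤ 2σ³` and density `σ³` (`Theorems.KiferCompactification.stub_diluteGibbsStateOfFact` at
`θ = 1`, `u₀ = 0`). CONDITIONAL on the named fact. [cite: Ruelle1969, Thm 4.2.3 and Thm 4.3.1] -/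
theorem diluteGibbsStateUnit_of_ruelle (hR : Literature.MathematicalPhysics.StatisticalMechanics.RuelleDiluteHardSphereGas) :
    ∃ σ₁ : ℝ, 0 < σ₁ ∧ ∀ σ : ℝ, 0 < σ → σ < σ₁ →
      ∃ (z : ℝ) (G : MeasureTheory.Measure Literature.MathematicalPhysics.KineticTheory.MarkedConfig),
        0 < z ∧ z ≤ 2 * σ ^ 3 ∧
        Literature.Analysis.FluidPDE.IsHardSphereGibbs 1 z 1
          (0 : Literature.MathematicalPhysics.KineticTheory.V3) G ∧
        Literature.Analysis.FluidPDE.IsTranslationInvariant G ∧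
        Literature.MathematicalPhysics.KineticTheory.PointProcess.density G = ENNReal.ofReal (σ ^ 3) := by
  obtain ⟨σ₁, hσ₁, H⟩ :=
    Summit.AtomisticToContinuum.HydrodynamicLimit.Theorems.KiferCompactification.stub_diluteGibbsStateOfFact hR
  refine ⟨σ₁, hσ₁, fun σ hσ hσ1 => ?_⟩
  obtain ⟨z, G, hz, hzle, hG, hti, hρ⟩ := H σ hσ hσ1 1 one_pos 0
  rw [inv_one] at hG
  exact ⟨z, G, hz, hzle, hG, hti, hρ⟩

/-- **Gluing the static and dynamic halves** into the v4 framework hypothesis (no orthogonality clause):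
thresholds combined by `min` with `σ < min 2⁻¹ (z₀/2)` so that `z ≤ 2σ³ ≤ 2σ < z₀`; the density clause
`∫ cellCharge 0 ∂F.μ = σ³` from `PointProcess.density G = σ³` (`integral_cellCharge_zero_eq_toReal_density`,
hard core a.e. since the equilibrium flow is a.e. defined on the Gibbs state `F.μ`). [folklore] -/
theorem frameworkNoOrth_of_split
    (h1a : ∃ σ₁ : ℝ, 0 < σ₁ ∧ ∀ σ : ℝ, 0 < σ → σ < σ₁ →
      ∃ (z : ℝ) (G : MeasureTheory.Measure Literature.MathematicalPhysics.KineticTheory.MarkedConfig),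
        0 < z ∧ z ≤ 2 * σ ^ 3 ∧
        Literature.Analysis.FluidPDE.IsHardSphereGibbs 1 z 1
          (0 : Literature.MathematicalPhysics.KineticTheory.V3) G ∧
        Literature.Analysis.FluidPDE.IsTranslationInvariant G ∧
        Literature.MathematicalPhysics.KineticTheory.PointProcess.density G = ENNReal.ofReal (σ ^ 3))
    (h1b : ∃ σ₃ : ℝ, 0 < σ₃ ∧ ∀ σ : ℝ, 0 < σ → σ < σ₃ → ∀ z : ℝ, 0 < z → z ≤ 2 * σ ^ 3 →
      ∀ G : MeasureTheory.Measure Literature.MathematicalPhysics.KineticTheory.MarkedConfig,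
        Literature.Analysis.FluidPDE.IsHardSphereGibbs 1 z 1
          (0 : Literature.MathematicalPhysics.KineticTheory.V3) G →
        Literature.Analysis.FluidPDE.IsTranslationInvariant G →
        Literature.MathematicalPhysics.KineticTheory.PointProcess.density G = ENNReal.ofReal (σ ^ 3) →
        ∃ F : Literature.MathematicalPhysics.KineticTheory.HardSphereFluctuationData 1,
          F.μ = G ∧
          (∃ Φ : Literature.Analysis.FluidPDE.InfiniteHardSphereFlow (Fin 3) 1,
            Φ.IsEquilibriumFlow ∧ ∀ t : ℝ, F.flow t =ᵐ[F.μ] Φ.flow t) ∧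
          (∀ ψ : Literature.MathematicalPhysics.KineticTheory.HardSphereFluctuationSpace F,
            Continuous fun t : ℝ => F.koopman t ψ) ∧
          (∀ g : Literature.MathematicalPhysics.KineticTheory.V3 → ℝ, Continuous g →
            (∃ (C : ℝ) (k : ℕ), ∀ v, |g v| ≤ C * (1 + ‖v‖) ^ k) →
            Literature.MathematicalPhysics.KineticTheory.cellObs g ∈ F.localObs)) :
    ∀ z₀ : ℝ, 0 < z₀ → ∃ σ₁ : ℝ, 0 < σ₁ ∧ ∀ σ : ℝ, 0 < σ → σ < σ₁ →
      ∃ (F : Literature.MathematicalPhysics.KineticTheory.HardSphereFluctuationData 1) (z : ℝ),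
        0 < z ∧ z < z₀ ∧
        Literature.Analysis.FluidPDE.IsHardSphereGibbs 1 z 1
          (0 : Literature.MathematicalPhysics.KineticTheory.V3) F.μ ∧
        (∃ Φ : Literature.Analysis.FluidPDE.InfiniteHardSphereFlow (Fin 3) 1,
          Φ.IsEquilibriumFlow ∧ ∀ t : ℝ, F.flow t =ᵐ[F.μ] Φ.flow t) ∧
        (∫ ω, Literature.MathematicalPhysics.KineticTheory.cellCharge 0 ω ∂F.μ = σ ^ 3) ∧
        (∀ ψ : Literature.MathematicalPhysics.KineticTheory.HardSphereFluctuationSpace F,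
          Continuous fun t : ℝ => F.koopman t ψ) ∧
        (∀ g : Literature.MathematicalPhysics.KineticTheory.V3 → ℝ, Continuous g →
          (∃ (C : ℝ) (k : ℕ), ∀ v, |g v| ≤ C * (1 + ‖v‖) ^ k) →
          Literature.MathematicalPhysics.KineticTheory.cellObs g ∈ F.localObs) := by
  intro z₀ hz₀
  obtain ⟨σ₁, hσ₁, hstate⟩ := h1a
  obtain ⟨σ₃, hσ₃, hpack⟩ := h1b
  refine ⟨min (min σ₁ σ₃) (min (1 / 2) (z₀ / 2)),
    lt_min (lt_min hσ₁ hσ₃) (lt_min one_half_pos (half_pos hz₀)), fun σ hσ hσlt => ?_⟩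
  have hσ1 : σ < σ₁ := lt_of_lt_of_le hσlt ((min_le_left _ _).trans (min_le_left _ _))
  have hσ3 : σ < σ₃ := lt_of_lt_of_le hσlt ((min_le_left _ _).trans (min_le_right _ _))
  have hσhalf : σ < 1 / 2 := lt_of_lt_of_le hσlt ((min_le_right _ _).trans (min_le_left _ _))
  have hσm : σ < z₀ / 2 := lt_of_lt_of_le hσlt ((min_le_right _ _).trans (min_le_right _ _))
  obtain ⟨z, G, hz, hzle, hGibbsG, hti, hρ⟩ := hstate σ hσ hσ1
  obtain ⟨F, hFμ, hflow, hcont, hobs⟩ := hpack σ hσ hσ3 z hz hzle G hGibbsG hti hρ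
  have hGibbs : Literature.Analysis.FluidPDE.IsHardSphereGibbs 1 z 1
      (0 : Literature.MathematicalPhysics.KineticTheory.V3) F.μ := by
    rw [hFμ]; exact hGibbsG
  have hσ3le : σ ^ 3 ≤ σ := by
    calc σ ^ 3 = σ * (σ * σ) := by ring
      _ ≤ σ * (1 * 1) := by gcongr <;> linarith
      _ = σ := by ring
  have hzlt : z < z₀ := by linarith
  have hcore : ∀ᵐ ω ∂F.μ, Literature.Analysis.FluidPDE.IsHardCore 1 ω := by
    obtain ⟨Ψ, hΨ, -⟩ := hflow
    exact Ψ.isHardCore_ae (hΨ z 1 hz one_pos F.μ hGibbs).1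
  have hdens : ∫ ω, Literature.MathematicalPhysics.KineticTheory.cellCharge 0 ω ∂F.μ = σ ^ 3 := by
    rw [Summit.AtomisticToContinuum.HydrodynamicLimit.Theorems.MourreKoopmanChargesStressStrongMixing.integral_cellCharge_zero_eq_toReal_density
      one_pos hcore, hFμ, hρ, ENNReal.toReal_ofReal (by positivity)]
  exact ⟨F, z, hz, hzlt, hGibbs, hflow, hdens, hcont, hobs⟩

/-- **REDUCTION OF THE CRUX, v5** (kernel-checked, axiom-clean): the static dilute Gibbs state
(registered stub `stub_diluteGibbsStateUnit`), its dynamical packaging (registered stub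
`stub_fluctuationPackagingUnit`), the unit-diameter diagonal identification (registered stub
`stub_torusIdentificationUnit`) and the route item `ChargesCompleteHS` (stmt-14141) imply the crux
`MourreKoopmanCharges.OneBodyCompleteness` BY NAME. [folklore] -/
theorem oneBodyCompleteness_of_split :
    (∃ σ₁ : ℝ, 0 < σ₁ ∧ ∀ σ : ℝ, 0 < σ → σ < σ₁ →
      ∃ (z : ℝ) (G : MeasureTheory.Measure Literature.MathematicalPhysics.KineticTheory.MarkedConfig),
        0 < z ∧ z ≤ 2 * σ ^ 3 ∧
        Literature.Analysis.FluidPDE.IsHardSphereGibbs 1 z 1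
          (0 : Literature.MathematicalPhysics.KineticTheory.V3) G ∧
        Literature.Analysis.FluidPDE.IsTranslationInvariant G ∧
        Literature.MathematicalPhysics.KineticTheory.PointProcess.density G = ENNReal.ofReal (σ ^ 3)) →
    (∃ σ₃ : ℝ, 0 < σ₃ ∧ ∀ σ : ℝ, 0 < σ → σ < σ₃ → ∀ z : ℝ, 0 < z → z ≤ 2 * σ ^ 3 →
      ∀ G : MeasureTheory.Measure Literature.MathematicalPhysics.KineticTheory.MarkedConfig,
        Literature.Analysis.FluidPDE.IsHardSphereGibbs 1 z 1
          (0 : Literature.MathematicalPhysics.KineticTheory.V3) G →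
        Literature.Analysis.FluidPDE.IsTranslationInvariant G →
        Literature.MathematicalPhysics.KineticTheory.PointProcess.density G = ENNReal.ofReal (σ ^ 3) →
        ∃ F : Literature.MathematicalPhysics.KineticTheory.HardSphereFluctuationData 1,
          F.μ = G ∧
          (∃ Φ : Literature.Analysis.FluidPDE.InfiniteHardSphereFlow (Fin 3) 1,
            Φ.IsEquilibriumFlow ∧ ∀ t : ℝ, F.flow t =ᵐ[F.μ] Φ.flow t) ∧
          (∀ ψ : Literature.MathematicalPhysics.KineticTheory.HardSphereFluctuationSpace F,
            Continuous fun t : ℝ => F.koopman t ψ) ∧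
          (∀ g : Literature.MathematicalPhysics.KineticTheory.V3 → ℝ, Continuous g →
            (∃ (C : ℝ) (k : ℕ), ∀ v, |g v| ≤ C * (1 + ‖v‖) ^ k) →
            Literature.MathematicalPhysics.KineticTheory.cellObs g ∈ F.localObs)) →
    (∃ z₂ : ℝ, 0 < z₂ ∧ ∀ σ : ℝ, 0 < σ → σ < 1 / 2 → ∀ z : ℝ, 0 < z → z < z₂ → ∀ θ : ℝ, 0 < θ →
      ∀ F : Literature.MathematicalPhysics.KineticTheory.HardSphereFluctuationData 1,
        Literature.Analysis.FluidPDE.IsHardSphereGibbs 1 z 1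
          (0 : Literature.MathematicalPhysics.KineticTheory.V3) F.μ →
        (∃ Φ : Literature.Analysis.FluidPDE.InfiniteHardSphereFlow (Fin 3) 1,
          Φ.IsEquilibriumFlow ∧ ∀ t : ℝ, F.flow t =ᵐ[F.μ] Φ.flow t) →
        (∫ ω, Literature.MathematicalPhysics.KineticTheory.cellCharge 0 ω ∂F.μ = σ ^ 3) →
        ∀ h : Literature.MathematicalPhysics.KineticTheory.V3 → ℝ, Continuous h →
          (∃ (C : ℝ) (k : ℕ), ∀ v, |h v| ≤ C * (1 + ‖v‖) ^ k) →
          Literature.MathematicalPhysics.KineticTheory.cellObs (fun w => h (Real.sqrt θ • w)) ∈ F.localObs →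
          (∫ v, h v * Literature.Analysis.FluidPDE.localMaxwellian 1 θ
              (0 : Literature.MathematicalPhysics.KineticTheory.V3) v = 0) →
          (∀ i : Fin 3, ∫ v, h v * v i * Literature.Analysis.FluidPDE.localMaxwellian 1 θ
              (0 : Literature.MathematicalPhysics.KineticTheory.V3) v = 0) →
          (∫ v, h v * ‖v‖ ^ 2 * Literature.Analysis.FluidPDE.localMaxwellian 1 θ
              (0 : Literature.MathematicalPhysics.KineticTheory.V3) v = 0) →
          ∃ K : ℝ, ∀ Φ : (N : ℕ) → Literature.Analysis.FluidPDE.HardSphereFlow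
              (Literature.Analysis.FluidPDE.Torus.geometry (Fin 3))
              (Literature.MathematicalPhysics.KineticTheory.hsDiameter σ N) (N + 1),
          ∀ χ : Literature.MathematicalPhysics.KineticTheory.T3 → ℝ, Continuous χ → ∀ s : ℝ,
            Tendsto (fun N : ℕ => ((N : ℝ) + 1) *
                cov[fun z => ∫ y, χ y.1 * h y.2 ∂(Literature.Analysis.FluidPDE.empiricalMeasure
                      ((Φ N).flow (s * ((N : ℝ) + 1) ^ (-(1 / 3 : ℝ))) z)),
                    fun z => ∫ y, χ y.1 * h y.2 ∂(Literature.Analysis.FluidPDE.empiricalMeasure z);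
                  Literature.MathematicalPhysics.KineticTheory.localGibbsLaw σ (fun _ => 1)
                    (fun _ => 0) (fun _ => θ) N (Φ N)])
              atTop (𝓝 ((∫ x, χ x * χ x) * K *
                ⟪F.koopman (Real.sqrt θ / σ * s)
                    (F.fluct (Literature.MathematicalPhysics.KineticTheory.cellObs
                      (fun w => h (Real.sqrt θ • w)))),
                  F.fluct (Literature.MathematicalPhysics.KineticTheory.cellObs
                    (fun w => h (Real.sqrt θ • w)))⟫_ℝ))) →
    Summit.AtomisticToContinuum.HydrodynamicLimit.Theses.MourreKoopmanCharges.ChargesCompleteHS →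
    Summit.AtomisticToContinuum.HydrodynamicLimit.Theses.MourreKoopmanCharges.OneBodyCompleteness := by
  intro h1a h1b h2 h3
  exact oneBodyCompleteness_of_frameworkNoOrth (frameworkNoOrth_of_split h1a h1b) h2 h3

/-- **The crux modulo Ruelle's theorem, the dynamical packaging, the identification and
`ChargesCompleteHS`**: `RuelleDiluteHardSphereGas → (packaging) → (identification) → ChargesCompleteHS →
OneBodyCompleteness` (CONDITIONAL on the named fact `RuelleDiluteHardSphereGas`). [cite: Ruelle1969, Thm 4.2.3] -/
theorem oneBodyCompleteness_of_ruelle (hR : Literature.MathematicalPhysics.StatisticalMechanics.RuelleDiluteHardSphereGas)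
    (h1b : ∃ σ₃ : ℝ, 0 < σ₃ ∧ ∀ σ : ℝ, 0 < σ → σ < σ₃ → ∀ z : ℝ, 0 < z → z ≤ 2 * σ ^ 3 →
      ∀ G : MeasureTheory.Measure Literature.MathematicalPhysics.KineticTheory.MarkedConfig,
        Literature.Analysis.FluidPDE.IsHardSphereGibbs 1 z 1
          (0 : Literature.MathematicalPhysics.KineticTheory.V3) G →
        Literature.Analysis.FluidPDE.IsTranslationInvariant G →
        Literature.MathematicalPhysics.KineticTheory.PointProcess.density G = ENNReal.ofReal (σ ^ 3) →
        ∃ F : Literature.MathematicalPhysics.KineticTheory.HardSphereFluctuationData 1,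
          F.μ = G ∧
          (∃ Φ : Literature.Analysis.FluidPDE.InfiniteHardSphereFlow (Fin 3) 1,
            Φ.IsEquilibriumFlow ∧ ∀ t : ℝ, F.flow t =ᵐ[F.μ] Φ.flow t) ∧
          (∀ ψ : Literature.MathematicalPhysics.KineticTheory.HardSphereFluctuationSpace F,
            Continuous fun t : ℝ => F.koopman t ψ) ∧
          (∀ g : Literature.MathematicalPhysics.KineticTheory.V3 → ℝ, Continuous g →
            (∃ (C : ℝ) (k : ℕ), ∀ v, |g v| ≤ C * (1 + ‖v‖) ^ k) →
            Literature.MathematicalPhysics.KineticTheory.cellObs g ∈ F.localObs))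
    (h2 : ∃ z₂ : ℝ, 0 < z₂ ∧ ∀ σ : ℝ, 0 < σ → σ < 1 / 2 → ∀ z : ℝ, 0 < z → z < z₂ → ∀ θ : ℝ, 0 < θ →
      ∀ F : Literature.MathematicalPhysics.KineticTheory.HardSphereFluctuationData 1,
        Literature.Analysis.FluidPDE.IsHardSphereGibbs 1 z 1
          (0 : Literature.MathematicalPhysics.KineticTheory.V3) F.μ →
        (∃ Φ : Literature.Analysis.FluidPDE.InfiniteHardSphereFlow (Fin 3) 1,
          Φ.IsEquilibriumFlow ∧ ∀ t : ℝ, F.flow t =ᵐ[F.μ] Φ.flow t) →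
        (∫ ω, Literature.MathematicalPhysics.KineticTheory.cellCharge 0 ω ∂F.μ = σ ^ 3) →
        ∀ h : Literature.MathematicalPhysics.KineticTheory.V3 → ℝ, Continuous h →
          (∃ (C : ℝ) (k : ℕ), ∀ v, |h v| ≤ C * (1 + ‖v‖) ^ k) →
          Literature.MathematicalPhysics.KineticTheory.cellObs (fun w => h (Real.sqrt θ • w)) ∈ F.localObs →
          (∫ v, h v * Literature.Analysis.FluidPDE.localMaxwellian 1 θ
              (0 : Literature.MathematicalPhysics.KineticTheory.V3) v = 0) →
          (∀ i : Fin 3, ∫ v, h v * v i * Literature.Analysis.FluidPDE.localMaxwellian 1 θ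
              (0 : Literature.MathematicalPhysics.KineticTheory.V3) v = 0) →
          (∫ v, h v * ‖v‖ ^ 2 * Literature.Analysis.FluidPDE.localMaxwellian 1 θ
              (0 : Literature.MathematicalPhysics.KineticTheory.V3) v = 0) →
          ∃ K : ℝ, ∀ Φ : (N : ℕ) → Literature.Analysis.FluidPDE.HardSphereFlow
              (Literature.Analysis.FluidPDE.Torus.geometry (Fin 3))
              (Literature.MathematicalPhysics.KineticTheory.hsDiameter σ N) (N + 1),
          ∀ χ : Literature.MathematicalPhysics.KineticTheory.T3 → ℝ, Continuous χ → ∀ s : ℝ,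
            Tendsto (fun N : ℕ => ((N : ℝ) + 1) *
                cov[fun z => ∫ y, χ y.1 * h y.2 ∂(Literature.Analysis.FluidPDE.empiricalMeasure
                      ((Φ N).flow (s * ((N : ℝ) + 1) ^ (-(1 / 3 : ℝ))) z)),
                    fun z => ∫ y, χ y.1 * h y.2 ∂(Literature.Analysis.FluidPDE.empiricalMeasure z);
                  Literature.MathematicalPhysics.KineticTheory.localGibbsLaw σ (fun _ => 1)
                    (fun _ => 0) (fun _ => θ) N (Φ N)])
              atTop (𝓝 ((∫ x, χ x * χ x) * K *
                ⟪F.koopman (Real.sqrt θ / σ * s)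
                    (F.fluct (Literature.MathematicalPhysics.KineticTheory.cellObs
                      (fun w => h (Real.sqrt θ • w)))),
                  F.fluct (Literature.MathematicalPhysics.KineticTheory.cellObs
                    (fun w => h (Real.sqrt θ • w)))⟫_ℝ)))
    (h3 : Summit.AtomisticToContinuum.HydrodynamicLimit.Theses.MourreKoopmanCharges.ChargesCompleteHS) :
    Summit.AtomisticToContinuum.HydrodynamicLimit.Theses.MourreKoopmanCharges.OneBodyCompleteness :=
  oneBodyCompleteness_of_split (diluteGibbsStateUnit_of_ruelle hR) h1b h2 h3

end Summit.AtomisticToContinuum.HydrodynamicLimit.Theorems.MourreKoopmanChargesOneBodyCompleteness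

end
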